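import Literature.NumberTheory.Sieve.LargestPrimeFactorCubicTBound
import Literature.NumberTheory.Sieve.LargestPrimeFactorCubicDivisorSetK
import Literature.NumberTheory.Sieve.LargestPrimeFactorCubicWeightedMertens
import HarnessLib

/-!
# Irving 2015, Lemma 4.2: the second (tilted) estimate for `T(h,δ)`

Ninth proved layer under the named fact `Irving2015_largestPrimeFactor_cubic`
(`LargestPrimeFactorCubic.lean`; A. J. Irving, arXiv:1412.0024 = Acta Arith. 171 (2015)), the
analytic half of §4.  With `k(n) = max{k ≤ K : p₁⋯p_k ≤ 3X}` (`…DivisorSetK`), Irving covers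
`T(h,δ)` by `𝒟 = ⋃_{k=[h/3]}^K 𝒟_k`, where for `k < K` the divisors obey the extra constraint (4.1);
he handles (4.1) by multiplying by `exp(α(s₁ + … + s_k − (h−k−3)/(h−k−1))) ≥ 1` (`s_i = log p_i/log X`)
and evaluates the tilted prime sums by partial summation.  Everything here is PROVED:

* `Irving2015.rootCount_mul_rpow_eq_prod_of_squarefree`, `Irving2015.sum_squarefree_rootCount_rpow_le`
  (the tilted `e_k`), `Irving2015.sum_divisorSetK_rootCount_div_le` —
  `∑_{d∈𝒟_k} ν(d)/d ≤ D_min^{-θ}·((∑_{p∈𝒫} ν(p)p^{θ-1})^k/k! + (3X)^θ W^k(1 + log 3X)(2/z))` for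
  `θ ≥ 0` and a floor `D_min ≤ d` on `𝒟_k`;
* `Irving2015.sum_mul_rpow_le_integral_exp` — the tilted prime sum by partial summation
  (`…WeightedMertens.sum_mul_le_integral_add` with `g = t^θ`, then `u = log t`, `u = Ls`):
  `∑_{p∈𝒫} a_p p^θ ≤ ∫_{log(z−1)/L}^{log Z/L} e^{θLs} ds/s + 4C Z^θ/log²(z−1)`;
* `Irving2015.integral_le_integral_add_endpoints` — endpoint perturbation of `∫ f`;
* `Irving2015.sum_card_dvd_divisorSetK_le_eventually` — **the term `k < K` of Lemma 4.2**: for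
  `0 < δ ≤ 1/20`, `k < K`, `K+1 ≤ h`, `(h−k+1)δ ≤ 3−(k−1)δ`, `α > 0`, `ε > 0`, for all large `X`,
  `∑_{d∈𝒟_k(X)} A_d ≤ (e^{-ασ_k}/k!·(∫_δ^{b_k} e^{αs} ds/s)^k + ε)·X`, `σ_k = (h−k−3)/(h−k−1)`,
  `b_k = (3−(k−1)δ)/(h−k+1)` (tilt `θ = α/log X`, floor `D_min = ((3X)^{h-k}/(10X³))^{1/(h-k-1)}`,
  `D_min^{-θ} → e^{-ασ_k}`, prime sum `→ ∫_δ^{b_k} e^{αs}ds/s`, error terms as in Lemma 3.2);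
* `Irving2015.sum_card_dvd_divisorSetK_top_le_eventually` — the term `k = K` (Lemma 3.2's core);
* `Irving2015.irving_lemma_4_2` — **Lemma 4.2**: for `0 < δ ≤ 1/20`, `h ≥ 3`, `[h/3] ≤ K ≤ h−1`,
  `α_k > 0`, `(h−k+1)δ ≤ 3−(k−1)δ` on `[[h/3], K]`, `ε > 0`, for all large `X`,
  `T(h,δ) ≤ X·(∑_{k=[h/3]}^{K-1} e^{-α_k σ_k}/k!·(∫_δ^{b_k} e^{α_k s} ds/s)^k + (log(b_K/δ))^K/K! + ε)`.

Restrictions relative to the printed lemma: `δ ≤ 1/20`, `K + 1 ≤ h`, and the sign conditions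
`(h−k+1)δ ≤ 3−(k−1)δ` (all satisfied in §5: `δ = 1/321`, `133 ≤ h ≤ 189`, `K = [h/3] + 20`).
The heavy term-`k` proof runs under `set_option maxHeartbeats 800000`.

## References

* A. J. Irving, *The largest prime factor of `X³ + 2`*, arXiv:1412.0024; Acta Arith. 171 (2015)
  67–80, §4, Lemmas 4.1–4.2. [`Irving2014LargestPrimeFactorCubic`]
-/

noncomputable section

open Finset

namespace Literature.NumberTheory.Sieve

namespace Irving2015

open MeasureTheory intervalIntegral

/-! ## Irving §4: the tilted divisor-set sums -/

section Tilted

/-- For squarefree `d` and `θ ∈ ℝ`, `ν(d) d^{θ-1} = ∏_{p ∣ d} ν(p) p^{θ-1}`. [folklore] -/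
theorem rootCount_mul_rpow_eq_prod_of_squarefree {d : ℕ} (hsq : Squarefree d) (θ : ℝ) :
    (#((range d).filter fun s : ℕ => d ∣ s ^ 3 + 2) : ℝ) * (d : ℝ) ^ (θ - 1) =
      ∏ p ∈ d.primeFactors, (#((range p).filter fun s : ℕ => p ∣ s ^ 3 + 2) : ℝ) * (p : ℝ) ^ (θ - 1) := by
  have hd : d ≠ 0 := hsq.ne_zero
  have hd0 : (0 : ℝ) < d := by exact_mod_cast Nat.pos_of_ne_zero hd
  have h1 := rootCount_div_eq_prod_of_squarefree hsq
  have hdprod : ∏ p ∈ d.primeFactors, (p : ℝ) = d := by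
    rw [← Nat.cast_prod, Nat.prod_primeFactors_of_squarefree hsq]
  have hrpow : (d : ℝ) ^ θ = ∏ p ∈ d.primeFactors, (p : ℝ) ^ θ := by
    rw [← hdprod, Real.finsetProd_rpow _ _ (fun p _ => Nat.cast_nonneg p)]
  calc (#((range d).filter fun s : ℕ => d ∣ s ^ 3 + 2) : ℝ) * (d : ℝ) ^ (θ - 1)
      = ((#((range d).filter fun s : ℕ => d ∣ s ^ 3 + 2) : ℝ) / d) * (d : ℝ) ^ θ := by
        rw [Real.rpow_sub hd0, Real.rpow_one]; field_simp
    _ = (∏ p ∈ d.primeFactors, (#((range p).filter fun s : ℕ => p ∣ s ^ 3 + 2) : ℝ) / p) *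
          ∏ p ∈ d.primeFactors, (p : ℝ) ^ θ := by rw [h1, hrpow]
    _ = ∏ p ∈ d.primeFactors, ((#((range p).filter fun s : ℕ => p ∣ s ^ 3 + 2) : ℝ) / p *
          (p : ℝ) ^ θ) := by rw [← prod_mul_distrib]
    _ = _ := by
        refine prod_congr rfl (fun p hp => ?_)
        have hp0 : (0 : ℝ) < p := by exact_mod_cast (Nat.prime_of_mem_primeFactors hp).pos
        rw [Real.rpow_sub hp0, Real.rpow_one]; field_simp

/-- **The tilted squarefree sum** (Irving §4: "multiplying the integrand by
`exp(α(s₁ + … + s_k − …))`"): for `θ ∈ ℝ`, the squarefree part of `∑_{d∈𝒟_k} ν(d) d^{θ-1}` is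
at most `e_k(b) ≤ (∑_{p∈𝒫} b_p)^k/k!` with `b_p = ν(p) p^{θ-1}`.
[cite: Irving2014LargestPrimeFactorCubic, §4 (p. 7)] -/
theorem sum_squarefree_rootCount_rpow_le (X z h k : ℕ) (θ : ℝ) :
    ∑ d ∈ ((Icc 1 (3 * X)).filter (fun d : ℕ => ArithmeticFunction.cardFactors d = k ∧
        (∀ p ∈ d.primeFactors, z ≤ p ∧ z ^ (k - 1) * p ^ (h - k + 1) ≤ 10 * X ^ 3))).filter
          (fun d => Squarefree d),
        (#((range d).filter fun s : ℕ => d ∣ s ^ 3 + 2) : ℝ) * (d : ℝ) ^ (θ - 1) ≤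
      (∑ p ∈ (Nat.primesLE (3 * X)).filter
          (fun p => z ≤ p ∧ z ^ (k - 1) * p ^ (h - k + 1) ≤ 10 * X ^ 3),
        (#((range p).filter fun s : ℕ => p ∣ s ^ 3 + 2) : ℝ) * (p : ℝ) ^ (θ - 1)) ^ k /
        k.factorial := by
  classical
  set P := (Nat.primesLE (3 * X)).filter
    (fun p => z ≤ p ∧ z ^ (k - 1) * p ^ (h - k + 1) ≤ 10 * X ^ 3) with hP
  set Dsf := ((Icc 1 (3 * X)).filter (fun d : ℕ => ArithmeticFunction.cardFactors d = k ∧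
    (∀ p ∈ d.primeFactors, z ≤ p ∧ z ^ (k - 1) * p ^ (h - k + 1) ≤ 10 * X ^ 3))).filter
      (fun d => Squarefree d) with hDsf
  set b : ℕ → ℝ := fun p => (#((range p).filter fun s : ℕ => p ∣ s ^ 3 + 2) : ℝ) * (p : ℝ) ^ (θ - 1)
    with hb
  have hb0 : ∀ p, 0 ≤ b p := fun p => by rw [hb]; positivity
  have hmemD : ∀ d ∈ Dsf, Squarefree d ∧ d.primeFactors ∈ P.powersetCard k := by
    intro d hd
    rw [hDsf, mem_filter, mem_filter, mem_Icc] at hd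
    obtain ⟨⟨⟨hd1, hd3X⟩, hΩ, hpf⟩, hsq⟩ := hd
    refine ⟨hsq, mem_powersetCard.2 ⟨fun p hp => ?_, ?_⟩⟩
    · have hpp := Nat.prime_of_mem_primeFactors hp
      have hple : p ≤ 3 * X := (Nat.le_of_dvd hd1 (Nat.dvd_of_mem_primeFactors hp)).trans hd3X
      rw [hP, mem_filter, Nat.mem_primesLE]
      exact ⟨⟨hple, hpp⟩, hpf p hp⟩
    · rw [← hΩ, ← (ArithmeticFunction.cardDistinctFactors_eq_cardFactors_iff_squarefree
        (by omega)).2 hsq, ArithmeticFunction.cardDistinctFactors_apply, ← List.card_toFinset,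
        Nat.toFinset_factors]
  have hinj : ∀ d₁ ∈ Dsf, ∀ d₂ ∈ Dsf, d₁.primeFactors = d₂.primeFactors → d₁ = d₂ := by
    intro d₁ h₁ d₂ h₂ heq
    rw [← Nat.prod_primeFactors_of_squarefree (hmemD d₁ h₁).1,
      ← Nat.prod_primeFactors_of_squarefree (hmemD d₂ h₂).1, heq]
  calc ∑ d ∈ Dsf, (#((range d).filter fun s : ℕ => d ∣ s ^ 3 + 2) : ℝ) * (d : ℝ) ^ (θ - 1)
      = ∑ d ∈ Dsf, ∏ p ∈ d.primeFactors, b p :=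
        sum_congr rfl (fun d hd => rootCount_mul_rpow_eq_prod_of_squarefree (hmemD d hd).1 θ)
    _ = ∑ s ∈ Dsf.image Nat.primeFactors, ∏ p ∈ s, b p := by rw [sum_image hinj]
    _ ≤ ∑ s ∈ P.powersetCard k, ∏ p ∈ s, b p := by
        refine sum_le_sum_of_subset_of_nonneg (fun s hs => ?_) (fun s _ _ => prod_nonneg fun p _ => hb0 p)
        rw [mem_image] at hs
        obtain ⟨d, hd, rfl⟩ := hs
        exact (hmemD d hd).2
    _ ≤ (∑ p ∈ P, b p) ^ k / k.factorial :=
        CubicSieve.esymm_le_pow_div_factorial P b (fun p _ => hb0 p) k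

/-- **The tilted divisor-set sum** (Irving §4): for `θ ≥ 0`, `Dm > 0` with `Dm ≤ d` for all
`d ∈ 𝒟_k` (the lower bound (4.1) when `k < K`, else `Dm = 1`), `X ≥ 1`, `z ≥ 1`,
`∑_{d∈𝒟_k} ν(d)/d ≤ Dm^{-θ}·((∑_{p∈𝒫} ν(p)p^{θ-1})^k/k! + (3X)^θ W^k (1 + log 3X)(2/z))`.
[cite: Irving2014LargestPrimeFactorCubic, §4, Lemma 4.2 (proof)] -/
theorem sum_divisorSetK_rootCount_div_le {W : ℕ}
    (hW : ∀ p : ℕ, p.Prime → ∀ a : ℕ, #((range (p ^ a)).filter fun s : ℕ => p ^ a ∣ s ^ 3 + 2) ≤ W)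
    (X z h k : ℕ) (hz : 1 ≤ z) (hX : 1 ≤ X) (extra : ℕ → Prop) [DecidablePred extra]
    {θ Dm : ℝ} (hθ : 0 ≤ θ) (hDm : 0 < Dm)
    (hDmle : ∀ d ∈ (Icc 1 (3 * X)).filter (fun d : ℕ => ArithmeticFunction.cardFactors d = k ∧
        (∀ p ∈ d.primeFactors, z ≤ p ∧ z ^ (k - 1) * p ^ (h - k + 1) ≤ 10 * X ^ 3) ∧ extra d),
        Dm ≤ (d : ℝ)) :
    ∑ d ∈ (Icc 1 (3 * X)).filter (fun d : ℕ => ArithmeticFunction.cardFactors d = k ∧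
        (∀ p ∈ d.primeFactors, z ≤ p ∧ z ^ (k - 1) * p ^ (h - k + 1) ≤ 10 * X ^ 3) ∧ extra d),
        (#((range d).filter fun s : ℕ => d ∣ s ^ 3 + 2) : ℝ) / d ≤
      Dm ^ (-θ) * ((∑ p ∈ (Nat.primesLE (3 * X)).filter
            (fun p => z ≤ p ∧ z ^ (k - 1) * p ^ (h - k + 1) ≤ 10 * X ^ 3),
          (#((range p).filter fun s : ℕ => p ∣ s ^ 3 + 2) : ℝ) * (p : ℝ) ^ (θ - 1)) ^ k / k.factorial +
        ((3 * X : ℕ) : ℝ) ^ θ * ((W : ℝ) ^ k * ((1 + Real.log ((3 * X : ℕ) : ℝ)) * (2 / z)))) := by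
  classical
  set D := (Icc 1 (3 * X)).filter (fun d : ℕ => ArithmeticFunction.cardFactors d = k ∧
    (∀ p ∈ d.primeFactors, z ≤ p ∧ z ^ (k - 1) * p ^ (h - k + 1) ≤ 10 * X ^ 3)) with hD
  set De := (Icc 1 (3 * X)).filter (fun d : ℕ => ArithmeticFunction.cardFactors d = k ∧
    (∀ p ∈ d.primeFactors, z ≤ p ∧ z ^ (k - 1) * p ^ (h - k + 1) ≤ 10 * X ^ 3) ∧ extra d) with hDe
  set ν : ℕ → ℝ := fun d => (#((range d).filter fun s : ℕ => d ∣ s ^ 3 + 2) : ℝ) with hν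
  have hν0 : ∀ d, 0 ≤ ν d := fun d => by rw [hν]; positivity
  have hsub : De ⊆ D := by
    intro d hd
    rw [hDe, mem_filter] at hd
    rw [hD, mem_filter]
    exact ⟨hd.1, hd.2.1, hd.2.2.1⟩
  have hmemD : ∀ d ∈ D, (0 : ℝ) < d ∧ (d : ℝ) ≤ ((3 * X : ℕ) : ℝ) := by
    intro d hd
    rw [hD, mem_filter, mem_Icc] at hd
    exact ⟨by exact_mod_cast hd.1.1, by exact_mod_cast hd.1.2⟩
  -- pointwise tilt on `De`: `ν(d)/d ≤ Dm^{-θ} ν(d) d^{θ-1}`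
  have hpt : ∀ d ∈ De, ν d / d ≤ Dm ^ (-θ) * (ν d * (d : ℝ) ^ (θ - 1)) := by
    intro d hd
    obtain ⟨hd0, -⟩ := hmemD d (hsub hd)
    have hDd := hDmle d hd
    have h1 : (1 : ℝ) ≤ Dm ^ (-θ) * (d : ℝ) ^ θ := by
      rw [Real.rpow_neg hDm.le, ← div_eq_inv_mul, one_le_div (Real.rpow_pos_of_pos hDm θ)]
      exact Real.rpow_le_rpow hDm.le hDd hθ
    have hdθ : (0 : ℝ) < (d : ℝ) ^ θ := Real.rpow_pos_of_pos hd0 θ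
    calc ν d / d = (ν d * (d : ℝ) ^ (θ - 1)) * ((d : ℝ) ^ θ)⁻¹ := by
          rw [Real.rpow_sub hd0, Real.rpow_one]; field_simp
      _ ≤ (ν d * (d : ℝ) ^ (θ - 1)) * ((d : ℝ) ^ θ)⁻¹ * (Dm ^ (-θ) * (d : ℝ) ^ θ) :=
          le_mul_of_one_le_right (by positivity) h1
      _ = Dm ^ (-θ) * (ν d * (d : ℝ) ^ (θ - 1)) := by field_simp
  -- the non-squarefree part of `D`: `ν(d) d^{θ-1} ≤ (3X)^θ ν(d)/d`
  have hX3 : (0 : ℝ) < ((3 * X : ℕ) : ℝ) := by exact_mod_cast (show 0 < 3 * X by omega)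
  have hnsf : ∑ d ∈ D.filter (fun d => ¬ Squarefree d), ν d * (d : ℝ) ^ (θ - 1) ≤
      ((3 * X : ℕ) : ℝ) ^ θ * ((W : ℝ) ^ k * ((1 + Real.log ((3 * X : ℕ) : ℝ)) * (2 / z))) := by
    have h0 := sum_nonsquarefree_rootCount_div_le hW X z h k hz hX
    calc ∑ d ∈ D.filter (fun d => ¬ Squarefree d), ν d * (d : ℝ) ^ (θ - 1)
        ≤ ∑ d ∈ D.filter (fun d => ¬ Squarefree d), ((3 * X : ℕ) : ℝ) ^ θ * (ν d / d) := by
          refine sum_le_sum (fun d hd => ?_)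
          obtain ⟨hd0, hd3⟩ := hmemD d (mem_filter.1 hd).1
          have hdθ : (d : ℝ) ^ θ ≤ ((3 * X : ℕ) : ℝ) ^ θ := Real.rpow_le_rpow hd0.le hd3 hθ
          calc ν d * (d : ℝ) ^ (θ - 1) = (ν d / d) * (d : ℝ) ^ θ := by
                rw [Real.rpow_sub hd0, Real.rpow_one]; field_simp
            _ ≤ (ν d / d) * ((3 * X : ℕ) : ℝ) ^ θ :=
                mul_le_mul_of_nonneg_left hdθ (div_nonneg (hν0 d) hd0.le)
            _ = ((3 * X : ℕ) : ℝ) ^ θ * (ν d / d) := by ring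
      _ = ((3 * X : ℕ) : ℝ) ^ θ * ∑ d ∈ D.filter (fun d => ¬ Squarefree d), ν d / d := by
          rw [mul_sum]
      _ ≤ ((3 * X : ℕ) : ℝ) ^ θ * ((W : ℝ) ^ k * ((1 + Real.log ((3 * X : ℕ) : ℝ)) * (2 / z))) :=
          mul_le_mul_of_nonneg_left h0 (by positivity)
  have hsf := sum_squarefree_rootCount_rpow_le X z h k θ
  have hsplit : ∑ d ∈ D, ν d * (d : ℝ) ^ (θ - 1) =
      ∑ d ∈ D.filter (fun d => Squarefree d), ν d * (d : ℝ) ^ (θ - 1) +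
      ∑ d ∈ D.filter (fun d => ¬ Squarefree d), ν d * (d : ℝ) ^ (θ - 1) :=
    (sum_filter_add_sum_filter_not D (fun d => Squarefree d) _).symm
  have hDm0 : 0 ≤ Dm ^ (-θ) := (Real.rpow_pos_of_pos hDm _).le
  calc ∑ d ∈ De, ν d / d ≤ ∑ d ∈ De, Dm ^ (-θ) * (ν d * (d : ℝ) ^ (θ - 1)) := sum_le_sum hpt
    _ = Dm ^ (-θ) * ∑ d ∈ De, ν d * (d : ℝ) ^ (θ - 1) := by rw [mul_sum]
    _ ≤ Dm ^ (-θ) * ∑ d ∈ D, ν d * (d : ℝ) ^ (θ - 1) := by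
        refine mul_le_mul_of_nonneg_left ?_ hDm0
        exact sum_le_sum_of_subset_of_nonneg hsub (fun d _ _ => by positivity)
    _ ≤ _ := by
        rw [hsplit]
        exact mul_le_mul_of_nonneg_left (add_le_add hsf hnsf) hDm0

end Tilted

/-! ## The tilted prime sum by partial summation (Irving §4: `→ ∫ e^{αs} ds/s`) -/

section TiltedPrimeSum

open MeasureTheory intervalIntegral

/-- **Irving 2015, §4** ("`∑ ν(p) p^{-1} e^{α s_p}`, `s_p = log p/log X`, by partial summation"):
for prime weights `a_p ≥ 0` with `|∑_{p≤t} a_p − log log t − c| ≤ C/log² t` (`t ≥ 2`), naturals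
`3 ≤ z`, `z − 1 ≤ Z`, and `θ > 0`, `L > 0`: any set `𝒫` of primes in `(z−1, Z]` has
`∑_{p∈𝒫} a_p p^θ ≤ ∫_{log(z−1)/L}^{log Z/L} e^{θLs} ds/s + 4C Z^θ/log²(z−1)`
(`sum_mul_le_integral_add` with `g(t) = t^θ`, then `u = log t`, `u = Ls`).
[cite: Irving2014LargestPrimeFactorCubic, §4 (p. 7)] -/
theorem sum_mul_rpow_le_integral_exp {a : ℕ → ℝ} (ha : ∀ p, 0 ≤ a p) {c C : ℝ}
    (hM : ∀ t : ℝ, 2 ≤ t →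
      |∑ p ∈ Nat.primesLE ⌊t⌋₊, a p - (Real.log (Real.log t) + c)| ≤ C / Real.log t ^ 2)
    {z Z : ℕ} (hz : 3 ≤ z) (hzZ : z - 1 ≤ Z) {θ L : ℝ} (hθ : 0 < θ) (hL : 0 < L)
    {P : Finset ℕ} (hP : P ⊆ (Nat.primesLE Z).filter (fun p : ℕ => (((z - 1 : ℕ) : ℝ)) < p)) :
    ∑ p ∈ P, a p * (p : ℝ) ^ θ ≤
      (∫ s in Real.log ((z - 1 : ℕ) : ℝ) / L..Real.log (Z : ℝ) / L, Real.exp (θ * L * s) / s) +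
        4 * C / Real.log ((z - 1 : ℕ) : ℝ) ^ 2 * (Z : ℝ) ^ θ := by
  set y : ℝ := ((z - 1 : ℕ) : ℝ) with hy
  set x : ℝ := (Z : ℝ) with hx
  have hy2 : (2 : ℝ) ≤ y := by rw [hy]; exact_mod_cast (show 2 ≤ z - 1 by omega)
  have hyx : y ≤ x := by rw [hy, hx]; exact_mod_cast hzZ
  have hy1 : 1 < y := by linarith
  -- the weight `g(t) = t^θ`
  have hg : ∀ t ∈ Set.Icc y x, HasDerivAt (fun t : ℝ => t ^ θ) (θ * t ^ (θ - 1)) t := by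
    intro t ht
    have ht0 : 0 < t := by linarith [ht.1]
    simpa using (Real.hasDerivAt_rpow_const (Or.inl ht0.ne') : HasDerivAt (fun t : ℝ => t ^ θ) _ t)
  have hg'c : ContinuousOn (fun t : ℝ => θ * t ^ (θ - 1)) (Set.Icc y x) := by
    refine ContinuousOn.mul continuousOn_const (ContinuousOn.rpow_const continuousOn_id fun t ht => ?_)
    exact Or.inl (show (id t : ℝ) ≠ 0 from (show (0 : ℝ) < t by linarith [ht.1]).ne')
  have hg'0 : ∀ t ∈ Set.Icc y x, 0 ≤ θ * t ^ (θ - 1) := fun t ht =>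
    mul_nonneg hθ.le (Real.rpow_nonneg (by linarith [ht.1]) _)
  have hg0 : ∀ t ∈ Set.Icc y x, 0 ≤ t ^ θ := fun t ht => Real.rpow_nonneg (by linarith [ht.1]) _
  have habel := sum_mul_le_integral_add ha hM hy2 hyx hg hg'c hg'0 hg0
  -- our sum is part of the left side
  have hfl : ⌊x⌋₊ = Z := by rw [hx]; exact Nat.floor_natCast Z
  have hsum : ∑ p ∈ P, a p * (p : ℝ) ^ θ ≤
      ∑ p ∈ (Nat.primesLE ⌊x⌋₊).filter (fun p : ℕ => y < (p : ℝ)), a p * (p : ℝ) ^ θ := by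
    rw [hfl]
    refine sum_le_sum_of_subset_of_nonneg hP (fun p _ _ => ?_)
    exact mul_nonneg (ha p) (Real.rpow_nonneg (Nat.cast_nonneg p) _)
  -- the integral, after `u = log t` and `u = L s`
  have hint : ∫ t in y..x, t ^ θ / (t * Real.log t) =
      ∫ s in Real.log y / L..Real.log x / L, Real.exp (θ * L * s) / s := by
    rw [integral_rpow_div_mul_log_eq hy1 hyx θ]
    have e : ∀ u : ℝ, Real.exp (θ * u) / u = Real.exp (θ * L / L * u) / u := by
      intro u; rw [mul_div_cancel_right₀ θ hL.ne']
    simp_rw [e]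
    rw [integral_exp_div_comp_div hL.ne' (θ * L)]
  rw [hint] at habel
  exact hsum.trans habel

end TiltedPrimeSum

/-! ## Irving's Lemma 4.2: the term `k < K`, asymptotically -/

section TermK

open MeasureTheory intervalIntegral Filter Topology

/-- Endpoint perturbation for the integral of a bounded nonnegative function: if `0 ≤ f ≤ M` on
`[m₀, M₀]` and `u, v, a, b ∈ [m₀, M₀]`, then
`∫_u^v f ≤ ∫_a^b f + M(|u − a| + |v − b|)`. [folklore] -/
theorem integral_le_integral_add_endpoints {f : ℝ → ℝ} {m₀ M₀ M u v a b : ℝ}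
    (hf : ContinuousOn f (Set.Icc m₀ M₀)) (hf0 : ∀ s ∈ Set.Icc m₀ M₀, 0 ≤ f s)
    (hfM : ∀ s ∈ Set.Icc m₀ M₀, f s ≤ M)
    (hu : u ∈ Set.Icc m₀ M₀) (hv : v ∈ Set.Icc m₀ M₀) (ha : a ∈ Set.Icc m₀ M₀)
    (hb : b ∈ Set.Icc m₀ M₀) :
    ∫ s in u..v, f s ≤ (∫ s in a..b, f s) + M * (|u - a| + |v - b|) := by
  have hM0 : 0 ≤ M := (hf0 a ha).trans (hfM a ha)
  have hint : ∀ p q : ℝ, p ∈ Set.Icc m₀ M₀ → q ∈ Set.Icc m₀ M₀ → IntervalIntegrable f volume p q := by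
    intro p q hp hq
    refine (hf.mono ?_).intervalIntegrable
    intro s hs
    rw [Set.uIcc] at hs
    exact ⟨le_trans (le_min hp.1 hq.1) hs.1, le_trans hs.2 (max_le hp.2 hq.2)⟩
  have hbound : ∀ p q : ℝ, p ∈ Set.Icc m₀ M₀ → q ∈ Set.Icc m₀ M₀ →
      |∫ s in p..q, f s| ≤ M * |q - p| := by
    intro p q hp hq
    have := intervalIntegral.norm_integral_le_of_norm_le_const (f := f) (a := p) (b := q) (C := M) ?_
    · simpa [Real.norm_eq_abs] using this
    · intro s hs
      have hs' : s ∈ Set.Icc m₀ M₀ := by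
        rw [Set.uIoc] at hs
        exact ⟨(le_min hp.1 hq.1).trans hs.1.le, hs.2.trans (max_le hp.2 hq.2)⟩
      rw [Real.norm_eq_abs, abs_of_nonneg (hf0 s hs')]
      exact hfM s hs'
  -- `∫_u^v = ∫_u^a + ∫_a^b + ∫_b^v`
  have h1 : ∫ s in u..v, f s = (∫ s in u..a, f s) + ((∫ s in a..b, f s) + ∫ s in b..v, f s) := by
    rw [integral_add_adjacent_intervals (hint a b ha hb) (hint b v hb hv),
      integral_add_adjacent_intervals (hint u a hu ha) (hint a v ha hv)]
  rw [h1]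
  have h2 := hbound u a hu ha
  have h3 := hbound b v hb hv
  have h2' := (abs_le.1 h2).2
  have h3' := (abs_le.1 h3).2
  rw [abs_sub_comm] at h2'
  nlinarith [h2', h3', abs_nonneg (u - a), abs_nonneg (v - b)]

set_option maxHeartbeats 800000 in
/-- **Irving 2015, Lemma 4.2, the term `k < K`**: for `0 < δ ≤ 1/20`, `k < K`, `K + 1 ≤ h`,
`(h−k+1)δ ≤ 3 − (k−1)δ`, `α > 0` and `ε > 0`, for all large `X` (threshold `z = ⌈X^δ⌉`),
`∑_{d∈𝒟_k(X)} A_d ≤ (e^{-ασ_k}/k!·(∫_δ^{b_k} e^{αs} ds/s)^k + ε)·X`,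
`σ_k = (h−k−3)/(h−k−1)`, `b_k = (3−(k−1)δ)/(h−k+1)`, where `𝒟_k(X)` carries the maximality
constraint (4.1) (`(3X)^{h-k} < 10X³ d^{h-k-1}`).  Proof: `sum_divisorSetK_rootCount_div_le` with
the tilt `θ = α/log X` and the floor `D_min = ((3X)^{h-k}/(10X³))^{1/(h-k-1)}`
(`D_min^{-θ} → e^{-ασ_k}`), the tilted prime sum by `sum_mul_rpow_le_integral_exp`
(`→ ∫_δ^{b_k} e^{αs} ds/s`), and the error terms as in Lemma 3.2.
[cite: Irving2014LargestPrimeFactorCubic, Lemma 4.2] -/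
theorem sum_card_dvd_divisorSetK_le_eventually {δ : ℝ} (hδ : 0 < δ) (hδ' : δ ≤ 1 / 20)
    {h K k : ℕ} (hkK : k < K) (hKh : K + 1 ≤ h)
    (hρ : ((h - k + 1 : ℕ) : ℝ) * δ ≤ 3 - ((k - 1 : ℕ) : ℝ) * δ) {α : ℝ} (hα : 0 < α)
    {ε : ℝ} (hε : 0 < ε) :
    ∀ᶠ X : ℕ in atTop,
      (∑ d ∈ (Icc 1 (3 * X)).filter (fun d : ℕ => ArithmeticFunction.cardFactors d = k ∧
          (∀ p ∈ d.primeFactors, ⌈(X : ℝ) ^ δ⌉₊ ≤ p ∧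
            ⌈(X : ℝ) ^ δ⌉₊ ^ (k - 1) * p ^ (h - k + 1) ≤ 10 * X ^ 3) ∧
          (k < K → (3 * X) ^ (h - k) < 10 * X ^ 3 * d ^ (h - k - 1))),
        (#((Ioc X (2 * X)).filter fun n : ℕ => d ∣ n ^ 3 + 2) : ℝ)) ≤
        (Real.exp (-α * (((h : ℝ) - k - 3) / ((h : ℝ) - k - 1))) *
            (∫ s in δ..(3 - ((k - 1 : ℕ) : ℝ) * δ) / ((h - k + 1 : ℕ) : ℝ),
              Real.exp (α * s) / s) ^ k / k.factorial + ε) * X := by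
  classical
  obtain ⟨W, Ks, hW1, hKs, hW, -⟩ := sum_card_dvd_divisorSet_le
  obtain ⟨Kr, hKr, hDcard⟩ := card_divisorSet_le
  obtain ⟨c₁, C₁, hM⟩ := exists_sum_rootCount_div_eq
  -- constants attached to `k`
  set m : ℕ := h - k + 1 with hm
  have hhk2 : 2 ≤ h - k := by omega
  have hm1 : 1 ≤ m := by omega
  have hmr : (1 : ℝ) ≤ m := by exact_mod_cast hm1
  set A : ℝ := 3 - ((k - 1 : ℕ) : ℝ) * δ with hA
  set b : ℝ := A / (m : ℝ) with hb
  have hmδ : 0 < (m : ℝ) * δ := by positivity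
  have hA0 : 0 < A := lt_of_lt_of_le hmδ hρ
  have hb0 : 0 < b := by rw [hb]; positivity
  have hδb : δ ≤ b := by rw [hb, le_div_iff₀ (by positivity)]; linarith only [hρ]
  set σ : ℝ := ((h : ℝ) - k - 3) / ((h : ℝ) - k - 1) with hσ
  set e : ℕ := h - k - 1 with he
  have he1 : 1 ≤ e := by omega
  have her : (0 : ℝ) < e := by exact_mod_cast he1
  have hhkr : ((h - k : ℕ) : ℝ) = (h : ℝ) - k := by
    rw [Nat.cast_sub (by omega)]
  have her' : (e : ℝ) = (h : ℝ) - k - 1 := by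
    rw [he, Nat.cast_sub (by omega), Nat.cast_sub (by omega)]; push_cast; ring
  -- the integrand `e^{αs}/s`, its bound `Mf` on `[δ/2, b + 1]`
  set Mf : ℝ := Real.exp (α * (b + 1)) / (δ / 2) with hMf
  have hfcont : ContinuousOn (fun s : ℝ => Real.exp (α * s) / s) (Set.Icc (δ / 2) (b + 1)) := by
    refine ContinuousOn.div (Continuous.continuousOn (by continuity)) continuousOn_id fun s hs => ?_
    exact (show (0 : ℝ) < s by linarith only [hs.1, hδ]).ne'
  have hf0 : ∀ s ∈ Set.Icc (δ / 2) (b + 1), 0 ≤ Real.exp (α * s) / s := fun s hs =>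
    div_nonneg (Real.exp_pos _).le (by linarith only [hs.1, hδ])
  have hfM : ∀ s ∈ Set.Icc (δ / 2) (b + 1), Real.exp (α * s) / s ≤ Mf := by
    intro s hs
    have hs0 : 0 < s := by linarith only [hs.1, hδ]
    rw [hMf, div_le_div_iff₀ hs0 (by positivity)]
    have h1 : Real.exp (α * s) ≤ Real.exp (α * (b + 1)) :=
      Real.exp_le_exp.2 (mul_le_mul_of_nonneg_left hs.2 hα.le)
    have h2 : Real.exp (α * s) * (δ / 2) ≤ Real.exp (α * s) * s :=
      mul_le_mul_of_nonneg_left hs.1 (Real.exp_pos _).le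
    have h3 : Real.exp (α * s) * s ≤ Real.exp (α * (b + 1)) * s :=
      mul_le_mul_of_nonneg_right h1 hs0.le
    linarith only [h2, h3]
  have hMf0 : 0 ≤ Mf := by rw [hMf]; positivity
  obtain ⟨I, hI⟩ : ∃ I : ℝ, I = ∫ s in δ..b, Real.exp (α * s) / s := ⟨_, rfl⟩
  have hI0 : 0 ≤ I := by
    rw [hI]
    refine intervalIntegral.integral_nonneg hδb fun s hs => hf0 s ⟨by linarith only [hs.1, hδ], by linarith only [hs.2]⟩
  -- Mertens constant is nonnegative
  have hC₁ : 0 ≤ C₁ := by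
    have h0 := (abs_nonneg _).trans (hM 2 le_rfl)
    have hpos : 0 < Real.log (2 : ℝ) ^ 2 := by positivity
    by_contra hneg
    have h1 : C₁ / Real.log (2 : ℝ) ^ 2 < 0 := div_neg_of_neg_of_pos (lt_of_not_ge hneg) hpos
    linarith only [h0, h1]
  -- the target constant and the `ε`-budget
  set E : ℝ := Real.exp (-α * σ) with hE
  have hE0 : 0 < E := Real.exp_pos _
  -- `t`: `(I + t')^k/k! ≤ I^k/k! + ε₁` with `ε₁ = ε/(4E)`
  have hε1 : 0 < ε / (4 * E) := by positivity
  obtain ⟨t, ht, hcont⟩ := exists_pow_div_factorial_le I hε1 k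
  -- `η ≤ 1`: `E e^{αη… } ≤ …`; we take one small parameter `η` for all the `o(1)`'s
  set η : ℝ := min (min 1 (t / (4 * (Mf + 1)))) (min (t / 2) (ε / (4 * (E + 1) * (I ^ k / k.factorial + ε / (4 * E) + 1) + 1))) with hη
  have hη0 : 0 < η := by rw [hη]; positivity
  have hη1 : η ≤ 1 := le_trans (min_le_left _ _) (min_le_left _ _)
  have hηt1 : η ≤ t / (4 * (Mf + 1)) := le_trans (min_le_left _ _) (min_le_right _ _)
  have hηt2 : η ≤ t / 2 := le_trans (min_le_right _ _) (min_le_left _ _)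
  have hηε : η ≤ ε / (4 * (E + 1) * (I ^ k / k.factorial + ε / (4 * E) + 1) + 1) :=
    le_trans (min_le_right _ _) (min_le_right _ _)
  set Wk : ℝ := (W : ℝ) ^ k with hWk
  have hWk1 : 1 ≤ Wk := by rw [hWk]; exact one_le_pow₀ (by exact_mod_cast hW1)
  set Wk' : ℝ := Real.exp (2 * α) * Wk with hWk'
  have hWk'0 : 0 ≤ Wk' := by rw [hWk']; positivity
  -- largeness conditions on `X`
  have hXδ : Tendsto (fun X : ℕ => (X : ℝ) ^ δ) atTop atTop :=
    (tendsto_rpow_atTop hδ).comp tendsto_natCast_atTop_atTop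
  have hXδ2 : Tendsto (fun X : ℕ => (X : ℝ) ^ (δ / 2)) atTop atTop :=
    (tendsto_rpow_atTop (by positivity)).comp tendsto_natCast_atTop_atTop
  have hXhalf : Tendsto (fun X : ℕ => (X : ℝ) ^ ((1 : ℝ) / 2)) atTop atTop :=
    (tendsto_rpow_atTop (by positivity)).comp tendsto_natCast_atTop_atTop
  have hlogX : Tendsto (fun X : ℕ => Real.log (X : ℝ)) atTop atTop :=
    Real.tendsto_log_atTop.comp tendsto_natCast_atTop_atTop
  -- `e^{αη'} ≤ 1 + η` for the small `η' = (log 10 + ...)/L`: we ask `L ≥ …`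
  obtain ⟨τ, hτ, hexpτ⟩ : ∃ τ : ℝ, 0 < τ ∧ ∀ τ' : ℝ, 0 ≤ τ' → τ' ≤ τ → Real.exp τ' ≤ 1 + η := by
    have hc : Tendsto (fun τ : ℝ => Real.exp τ) (𝓝 0) (𝓝 1) := by
      simpa using Real.continuous_exp.tendsto 0
    have hev := hc.eventually (Iic_mem_nhds (show (1 : ℝ) < 1 + η by linarith only [hη0]))
    obtain ⟨r, hr, hball⟩ := Metric.eventually_nhds_iff.1 hev
    refine ⟨r / 2, by positivity, fun τ' h0 h1 => hball ?_⟩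
    rw [Real.dist_eq, sub_zero, abs_of_nonneg h0]; linarith only [h1, hr]
  filter_upwards [eventually_ge_atTop 1,
    hXδ.eventually_ge_atTop 4,
    hXδ.eventually_ge_atTop (Real.exp (Real.sqrt (4 * C₁ * Real.exp (α * (b + 1)) / η)) * 2 + 2),
    hlogX.eventually_ge_atTop ((Real.log 10 + Real.log 2) / (η * δ)),
    hlogX.eventually_ge_atTop ((Real.log 10 + Real.log 2) * 2 / δ),
    hlogX.eventually_ge_atTop (Real.log 10 / m / η + Real.log 2 / η),
    hlogX.eventually_ge_atTop (α * Real.log 10 / τ),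
    hlogX.eventually_ge_atTop (Real.log 3),
    hXδ.eventually_ge_atTop (2 * Wk' * (1 + Real.log 3) * (6 / η)),
    hXδ2.eventually_ge_atTop (4 * Wk' / δ * (6 / η)),
    hlogX.eventually_ge_atTop (3 * Wk * Kr / δ * (6 / (ε / 4))),
    hXhalf.eventually_ge_atTop (1024 * Wk * Kr * (6 / (ε / 4)))]
    with X hX1 hz4 hzC hL1 hL2 hL3 hLτ hL3' hT1 hT2 hT3 hT4
  -- notation
  have hX0 : (0 : ℝ) < X := by exact_mod_cast hX1
  set L : ℝ := Real.log X with hL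
  have hlog4 : Real.log 4 ≤ δ * L := by
    rw [hL, ← Real.log_rpow hX0]; exact Real.log_le_log (by norm_num) hz4
  have hlog2 : 0 < Real.log 2 := Real.log_pos (by norm_num)
  have h42 : Real.log 2 < Real.log 4 := Real.log_lt_log (by norm_num) (by norm_num)
  have hδL : 0 < δ * L := by linarith only [hlog4, h42, hlog2]
  have hL0 : 0 < L := lt_of_mul_lt_mul_left (by simpa using hδL : δ * 0 < δ * L) hδ.le
  set z : ℕ := ⌈(X : ℝ) ^ δ⌉₊ with hz
  have hzge : (X : ℝ) ^ δ ≤ z := Nat.le_ceil _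
  have hzle : (z : ℝ) ≤ (X : ℝ) ^ δ + 1 := (Nat.ceil_lt_add_one (by positivity)).le
  have hz3 : 3 ≤ z := by
    have : (3 : ℝ) < z := by linarith only [hzge, hz4]
    exact_mod_cast this.le
  have hz2 : 2 ≤ z := by omega
  have hzr0 : (0 : ℝ) < z := by exact_mod_cast (show 0 < z by omega)
  have hlogz : δ * L ≤ Real.log z := by
    rw [hL, ← Real.log_rpow hX0]; exact Real.log_le_log (by positivity) hzge
  have hlogz' : Real.log z ≤ δ * L + Real.log 2 := by
    have h2X : (z : ℝ) ≤ 2 * (X : ℝ) ^ δ := by linarith only [hzle, hz4]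
    calc Real.log z ≤ Real.log (2 * (X : ℝ) ^ δ) := Real.log_le_log hzr0 h2X
      _ = δ * L + Real.log 2 := by
          rw [Real.log_mul (by norm_num) (by positivity), Real.log_rpow hX0, hL]; ring
  have hz1r : (X : ℝ) ^ δ / 2 ≤ (z : ℝ) - 1 := by linarith only [hzge, hz4]
  have hz1pos : (0 : ℝ) < (z : ℝ) - 1 := by linarith only [hzge, hz4]
  have hcast1 : ((z - 1 : ℕ) : ℝ) = (z : ℝ) - 1 := by rw [Nat.cast_sub (by omega)]; simp
  have hlogz1 : δ * L - Real.log 2 ≤ Real.log ((z : ℝ) - 1) := by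
    have : Real.log ((X : ℝ) ^ δ / 2) = δ * L - Real.log 2 := by
      rw [Real.log_div (by positivity) (by norm_num), Real.log_rpow hX0]
    rw [← this]; exact Real.log_le_log (by positivity) hz1r
  have hlogz1' : Real.log ((z : ℝ) - 1) ≤ δ * L + Real.log 2 :=
    (Real.log_le_log hz1pos (sub_le_self _ zero_le_one)).trans hlogz'
  have hlz1 : 0 < Real.log ((z : ℝ) - 1) := by linarith only [hlogz1, hlog4, h42]
  -- the tilt and the floor
  set θ : ℝ := α / L with hθ
  have hθ0 : 0 < θ := by rw [hθ]; positivity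
  have hθL : θ * L = α := by rw [hθ]; field_simp
  set Dm : ℝ := (((3 * X : ℕ) : ℝ) ^ (h - k) / (10 * (X : ℝ) ^ 3)) ^ ((e : ℝ)⁻¹) with hDm
  have hX3 : (0 : ℝ) < ((3 * X : ℕ) : ℝ) := by exact_mod_cast (show 0 < 3 * X by omega)
  have hbase : 0 < ((3 * X : ℕ) : ℝ) ^ (h - k) / (10 * (X : ℝ) ^ 3) := by positivity
  have hDm0 : 0 < Dm := Real.rpow_pos_of_pos hbase _
  -- the sets
  set D := (Icc 1 (3 * X)).filter (fun d : ℕ => ArithmeticFunction.cardFactors d = k ∧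
    (∀ p ∈ d.primeFactors, z ≤ p ∧ z ^ (k - 1) * p ^ (h - k + 1) ≤ 10 * X ^ 3)) with hD
  set De := (Icc 1 (3 * X)).filter (fun d : ℕ => ArithmeticFunction.cardFactors d = k ∧
    (∀ p ∈ d.primeFactors, z ≤ p ∧ z ^ (k - 1) * p ^ (h - k + 1) ≤ 10 * X ^ 3) ∧
    (k < K → (3 * X) ^ (h - k) < 10 * X ^ 3 * d ^ (h - k - 1))) with hDe
  have hsubD : De ⊆ D := by
    intro d hd; rw [hDe, mem_filter] at hd; rw [hD, mem_filter]; exact ⟨hd.1, hd.2.1, hd.2.2.1⟩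
  -- `Dm ≤ d` on `De`
  have hDmle : ∀ d ∈ De, Dm ≤ (d : ℝ) := by
    intro d hd
    rw [hDe, mem_filter] at hd
    have hc := hd.2.2.2 hkK
    have hd0 : (0 : ℝ) < d := by exact_mod_cast (mem_Icc.1 hd.1).1
    -- `(3X)^{h-k} < 10X³ d^{e}` in `ℝ`
    have hcr : ((3 * X : ℕ) : ℝ) ^ (h - k) < 10 * (X : ℝ) ^ 3 * (d : ℝ) ^ (e : ℕ) := by
      rw [he]; exact_mod_cast hc
    have h1 : ((3 * X : ℕ) : ℝ) ^ (h - k) / (10 * (X : ℝ) ^ 3) ≤ (d : ℝ) ^ (e : ℕ) := by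
      rw [div_le_iff₀ (by positivity)]; linarith only [hcr]
    calc Dm = (((3 * X : ℕ) : ℝ) ^ (h - k) / (10 * (X : ℝ) ^ 3)) ^ ((e : ℝ)⁻¹) := rfl
      _ ≤ ((d : ℝ) ^ (e : ℕ)) ^ ((e : ℝ)⁻¹) := Real.rpow_le_rpow hbase.le h1 (by positivity)
      _ = d := Real.pow_rpow_inv_natCast hd0.le (by omega)
  -- (I) the sum of the `A_d` over `De`
  have hνW : ∀ d ∈ De, (#((range d).filter fun s : ℕ => d ∣ s ^ 3 + 2) : ℝ) ≤ Wk := by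
    intro d hd
    rw [hDe, mem_filter, mem_Icc] at hd
    refine (rootCount_le_pow_cardDistinctFactors hW (by omega : d ≠ 0)).trans ?_
    rw [hWk, ← hd.2.1]
    refine pow_le_pow_right₀ (by exact_mod_cast hW1) ?_
    rw [ArithmeticFunction.cardDistinctFactors_apply, ArithmeticFunction.cardFactors_apply]
    exact (List.dedup_sublist _).length_le
  have hAd : ∀ d ∈ De, (#((Ioc X (2 * X)).filter fun n : ℕ => d ∣ n ^ 3 + 2) : ℝ) ≤
      X * ((#((range d).filter fun s : ℕ => d ∣ s ^ 3 + 2) : ℝ) / d) + Wk := by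
    intro d hd
    have hd0 : 0 < d := (mem_Icc.1 (mem_filter.1 hd).1).1
    have := card_Ioc_filter_dvd_le hd0 X
    calc (#((Ioc X (2 * X)).filter fun n : ℕ => d ∣ n ^ 3 + 2) : ℝ)
        ≤ #((range d).filter fun s : ℕ => d ∣ s ^ 3 + 2) * ((X : ℝ) / d + 1) := this
      _ = X * ((#((range d).filter fun s : ℕ => d ∣ s ^ 3 + 2) : ℝ) / d) +
            #((range d).filter fun s : ℕ => d ∣ s ^ 3 + 2) := by ring
      _ ≤ _ := by linarith only [hνW d hd]
  have hsumA : (∑ d ∈ De, (#((Ioc X (2 * X)).filter fun n : ℕ => d ∣ n ^ 3 + 2) : ℝ)) ≤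
      X * ∑ d ∈ De, (#((range d).filter fun s : ℕ => d ∣ s ^ 3 + 2) : ℝ) / d + Wk * #D := by
    calc (∑ d ∈ De, (#((Ioc X (2 * X)).filter fun n : ℕ => d ∣ n ^ 3 + 2) : ℝ))
        ≤ ∑ d ∈ De, (X * ((#((range d).filter fun s : ℕ => d ∣ s ^ 3 + 2) : ℝ) / d) + Wk) :=
          sum_le_sum hAd
      _ = X * ∑ d ∈ De, (#((range d).filter fun s : ℕ => d ∣ s ^ 3 + 2) : ℝ) / d + Wk * #De := by
          rw [sum_add_distrib, ← mul_sum, sum_const, nsmul_eq_mul]; ring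
      _ ≤ X * ∑ d ∈ De, (#((range d).filter fun s : ℕ => d ∣ s ^ 3 + 2) : ℝ) / d + Wk * #D := by
          have h1 : (#De : ℝ) ≤ #D := by exact_mod_cast card_le_card hsubD
          have h2 := mul_le_mul_of_nonneg_left h1 (by linarith only [hWk1] : (0 : ℝ) ≤ Wk)
          linarith only [h2]
  -- (II) the tilted bound for `∑_{De} ν(d)/d`
  have htilt := sum_divisorSetK_rootCount_div_le hW X z h k (by omega) hX1
    (fun d => k < K → (3 * X) ^ (h - k) < 10 * X ^ 3 * d ^ (h - k - 1)) hθ0.le hDm0 hDmle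
  -- (III) the tilted prime sum `Sb ≤ ∫ + err`
  set a : ℕ → ℝ := fun p => (#((range p).filter fun s : ℕ => p ∣ s ^ 3 + 2) : ℝ) / p with ha
  have ha0 : ∀ p, 0 ≤ a p := fun p => by rw [ha]; positivity
  set B : ℝ := 10 * (X : ℝ) ^ 3 / (z : ℝ) ^ (k - 1) with hB
  have hB0 : 0 ≤ B := by positivity
  set Zr : ℝ := B ^ ((m : ℝ)⁻¹) with hZr
  have hZr0 : 0 ≤ Zr := by positivity
  set Ztop : ℕ := max (z - 1) ⌊Zr⌋₊ with hZtop
  have hzZ : z - 1 ≤ Ztop := le_max_left _ _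
  set P := (Nat.primesLE (3 * X)).filter
    (fun p => z ≤ p ∧ z ^ (k - 1) * p ^ (h - k + 1) ≤ 10 * X ^ 3) with hP
  have hPsub : P ⊆ (Nat.primesLE Ztop).filter (fun p : ℕ => (((z - 1 : ℕ) : ℝ)) < p) := by
    intro p hp
    rw [hP, mem_filter, Nat.mem_primesLE] at hp
    obtain ⟨⟨-, hpp⟩, hzp, hbound⟩ := hp
    refine mem_filter.2 ⟨Nat.mem_primesLE.2 ⟨?_, hpp⟩, ?_⟩
    · refine le_trans ?_ (le_max_right _ _)
      refine Nat.le_floor ?_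
      have hpm : ((p : ℝ) ^ m) ≤ B := by
        rw [hB, le_div_iff₀ (by positivity)]
        have : ((z ^ (k - 1) * p ^ (h - k + 1) : ℕ) : ℝ) ≤ ((10 * X ^ 3 : ℕ) : ℝ) := by
          exact_mod_cast hbound
        push_cast at this
        rw [hm]; linarith only [this]
      have hp0 : (0 : ℝ) ≤ p := Nat.cast_nonneg p
      calc (p : ℝ) = ((p : ℝ) ^ m) ^ ((m : ℝ)⁻¹) := (Real.pow_rpow_inv_natCast hp0 (by omega)).symm
        _ ≤ B ^ ((m : ℝ)⁻¹) := Real.rpow_le_rpow (by positivity) hpm (by positivity)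
    · rw [hcast1]
      have : (z : ℝ) ≤ p := by exact_mod_cast hzp
      linarith only [this]
  have hSb_eq : ∑ p ∈ P, (#((range p).filter fun s : ℕ => p ∣ s ^ 3 + 2) : ℝ) * (p : ℝ) ^ (θ - 1) =
      ∑ p ∈ P, a p * (p : ℝ) ^ θ := by
    refine sum_congr rfl (fun p hp => ?_)
    have hpp := (Nat.mem_primesLE.1 (mem_filter.1 hp).1).2
    have hp0 : (0 : ℝ) < p := by exact_mod_cast hpp.pos
    rw [ha, Real.rpow_sub hp0, Real.rpow_one]; field_simp
  have hz12 : 2 ≤ z - 1 := by omega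
  have hSb := sum_mul_rpow_le_integral_exp ha0 hM hz3 hzZ hθ0 hL0 hPsub
  rw [hθL] at hSb
  -- the endpoints `u = log(z−1)/L`, `v = log Ztop/L`
  set u : ℝ := Real.log ((z - 1 : ℕ) : ℝ) / L with hu
  set v : ℝ := Real.log (Ztop : ℝ) / L with hv
  have hτL : (Real.log 10 + Real.log 2) / L ≤ η * δ := by
    rw [div_le_iff₀ hL0]
    have := hL1; rw [div_le_iff₀ (by positivity)] at this; linarith only [this]
  have hτL' : (Real.log 10 + Real.log 2) / L ≤ δ / 2 := by
    rw [div_le_iff₀ hL0]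
    have := hL2; rw [div_le_iff₀ hδ] at this; linarith only [this]
  have hu_lo : δ - (Real.log 10 + Real.log 2) / L ≤ u := by
    rw [hu, hcast1, le_div_iff₀ hL0, sub_mul, div_mul_cancel₀ _ hL0.ne']
    have : 0 ≤ Real.log 10 := Real.log_nonneg (by norm_num)
    linarith only [hlogz1, this]
  have hu_hi : u ≤ δ + (Real.log 10 + Real.log 2) / L := by
    rw [hu, hcast1, div_le_iff₀ hL0, add_mul, div_mul_cancel₀ _ hL0.ne']
    have : 0 ≤ Real.log 10 := Real.log_nonneg (by norm_num)
    linarith only [hlogz1', this]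
  -- `v ≤ max u (b + log 10/(m L))`
  have hZtop_pos : (0 : ℝ) < Ztop := by
    have : ((z - 1 : ℕ) : ℝ) ≤ Ztop := by exact_mod_cast hzZ
    rw [hcast1] at this; linarith only [this, hz1pos]
  have hv_le : v ≤ max u (b + Real.log 10 / L) := by
    have hZtop_le : (Ztop : ℝ) ≤ max ((z : ℝ) - 1) Zr := by
      rw [hZtop]; push_cast; rw [hcast1]
      exact max_le_max le_rfl (Nat.floor_le hZr0)
    rcases le_max_iff.1 hZtop_le with h1 | h1
    · refine le_max_of_le_left ?_
      rw [hv, hu, hcast1]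
      exact div_le_div_of_nonneg_right (Real.log_le_log hZtop_pos h1) hL0.le
    · refine le_max_of_le_right ?_
      rw [hv, div_le_iff₀ hL0]
      rcases eq_or_lt_of_le hB0 with hB00 | hBpos
      · -- `Zr = 0`: then `Ztop ≤ 0` contradicts positivity unless vacuous; bound trivially
        have : (Ztop : ℝ) ≤ 0 := by rw [hZr, ← hB00, Real.zero_rpow (by positivity)] at h1; exact h1
        linarith only [this, hZtop_pos]
      have hlogZr : Real.log Zr = (Real.log 10 + 3 * L - ((k - 1 : ℕ) : ℝ) * Real.log z) / m := by
        rw [hZr, Real.log_rpow hBpos, hB, Real.log_div (by positivity) (by positivity),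
          Real.log_mul (by norm_num) (by positivity), Real.log_pow, Real.log_pow, hL]
        push_cast; field_simp
      have hk1r : (0 : ℝ) ≤ ((k - 1 : ℕ) : ℝ) := Nat.cast_nonneg _
      have hlogZtop : Real.log (Ztop : ℝ) ≤ Real.log Zr := Real.log_le_log hZtop_pos h1
      have h2 : Real.log Zr ≤ b * L + Real.log 10 / m := by
        rw [hlogZr, hb, div_le_iff₀ (by positivity)]
        have hkl : ((k - 1 : ℕ) : ℝ) * (δ * L) ≤ ((k - 1 : ℕ) : ℝ) * Real.log z :=
          mul_le_mul_of_nonneg_left hlogz hk1r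
        have e1 : (A / m * L + Real.log 10 / m) * m = A * L + Real.log 10 := by field_simp
        rw [e1, hA]
        linarith only [hkl]
      have h3 : Real.log 10 / m ≤ Real.log 10 := by
        refine div_le_self (Real.log_nonneg (by norm_num)) hmr
      calc Real.log (Ztop : ℝ) ≤ b * L + Real.log 10 / m := hlogZtop.trans h2
        _ ≤ (b + Real.log 10 / L) * L := by rw [add_mul, div_mul_cancel₀ _ hL0.ne']; linarith only [h3]
  -- consequently `u, v ∈ [δ/2, b+1]` and `|u − δ|, (v − b)⁺ ≤ ηδ ≤ η`
  have hlog10L : Real.log 10 / L ≤ (Real.log 10 + Real.log 2) / L :=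
    div_le_div_of_nonneg_right (by linarith only [hlog2]) hL0.le
  have hηδ1 : η * δ ≤ 1 := mul_le_one₀ hη1 hδ.le (by linarith only [hδ'])
  have hηδ0 : 0 ≤ η * δ := (mul_pos hη0 hδ).le
  have hu_mem : u ∈ Set.Icc (δ / 2) (b + 1) :=
    ⟨by linarith only [hu_lo, hτL'], by linarith only [hu_hi, hτL, hδb, hηδ1]⟩
  have huv : u ≤ v := by
    rw [hu, hv]
    refine div_le_div_of_nonneg_right (Real.log_le_log (by rw [hcast1]; exact hz1pos) ?_) hL0.le
    exact_mod_cast hzZ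
  have hv_mem : v ∈ Set.Icc (δ / 2) (b + 1) := by
    constructor
    · linarith only [huv, hu_mem.1]
    · rcases le_max_iff.1 hv_le with h1 | h1
      · linarith only [h1, hu_mem.2]
      · linarith only [h1, hlog10L, hτL, hηδ1, hδb]
  have hδ_mem : δ ∈ Set.Icc (δ / 2) (b + 1) := ⟨by linarith only [hδ], by linarith only [hδb]⟩
  have hb_mem : b ∈ Set.Icc (δ / 2) (b + 1) :=
    ⟨by linarith only [hδ, hδb], le_add_of_nonneg_right zero_le_one⟩
  -- (IV) `∫_u^v f ≤ I + 3 Mf η`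
  set v' : ℝ := max v b with hv'
  have hv'_mem : v' ∈ Set.Icc (δ / 2) (b + 1) :=
    ⟨le_trans hv_mem.1 (le_max_left _ _), max_le hv_mem.2 (le_add_of_nonneg_right zero_le_one)⟩
  have huδ : |u - δ| ≤ η * δ := by
    rw [abs_le]; constructor <;> linarith only [hu_lo, hu_hi, hτL]
  have hv'b : |v' - b| ≤ 2 * (η * δ) := by
    have hmax := le_max_right v b
    have h0 : 0 ≤ v' - b := by rw [hv']; linarith only [hmax]
    rw [abs_of_nonneg h0, hv']
    rcases le_or_gt v b with hvb | hvb
    · rw [max_eq_right hvb]; linarith only [hηδ0]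
    · rw [max_eq_left hvb.le]
      rcases le_max_iff.1 hv_le with h1 | h1
      · have h2 := (abs_le.1 huδ).2
        linarith only [h1, h2, hδb, hηδ0]
      · linarith only [h1, hlog10L, hτL, hηδ0]
  have hIcc_sub : Set.Icc u v' ⊆ Set.Icc (δ / 2) (b + 1) := fun s hs =>
    ⟨le_trans hu_mem.1 hs.1, le_trans hs.2 hv'_mem.2⟩
  have hint_uv : ∫ s in u..v, Real.exp (α * s) / s ≤ ∫ s in u..v', Real.exp (α * s) / s := by
    refine intervalIntegral.integral_mono_interval le_rfl huv (le_max_left _ _) ?_ ?_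
    · rw [Filter.EventuallyLE, ae_restrict_iff' measurableSet_Ioc]
      refine Filter.Eventually.of_forall fun s hs => ?_
      exact hf0 s (hIcc_sub ⟨hs.1.le, hs.2⟩)
    · exact (hfcont.mono (by rw [Set.uIcc_of_le (huv.trans (le_max_left _ _))]; exact hIcc_sub)).intervalIntegrable
  have hint_end := integral_le_integral_add_endpoints hfcont hf0 hfM hu_mem hv'_mem hδ_mem hb_mem
  rw [← hI] at hint_end
  have hint : ∫ s in u..v, Real.exp (α * s) / s ≤ I + 3 * Mf * η := by
    have h1 : Mf * (|u - δ| + |v' - b|) ≤ Mf * (3 * (η * δ)) :=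
      mul_le_mul_of_nonneg_left (by linarith only [huδ, hv'b]) hMf0
    have h2 : Mf * (3 * (η * δ)) ≤ 3 * Mf * η := by
      have h3 : η * δ ≤ η := mul_le_of_le_one_right hη0.le (by linarith only [hδ'])
      have h4 := mul_le_mul_of_nonneg_left h3 hMf0
      linarith only [h4]
    linarith only [hint_uv, hint_end, h1, h2]
  -- (V) the Abel error `4C₁ Ztop^θ/log²(z−1) ≤ η`
  have hZθ : (Ztop : ℝ) ^ θ ≤ Real.exp (α * (b + 1)) := by
    rw [Real.rpow_def_of_pos hZtop_pos]
    refine Real.exp_le_exp.2 ?_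
    have : Real.log (Ztop : ℝ) * θ = α * v := by rw [hv, hθ]; field_simp
    rw [this]
    exact mul_le_mul_of_nonneg_left hv_mem.2 hα.le
  have herr : 4 * C₁ / Real.log ((z - 1 : ℕ) : ℝ) ^ 2 * (Ztop : ℝ) ^ θ ≤ η := by
    rw [hcast1]
    have hge : Real.exp (Real.sqrt (4 * C₁ * Real.exp (α * (b + 1)) / η)) ≤ (z : ℝ) - 1 := by
      linarith only [hzge, hzC, Real.exp_pos (Real.sqrt (4 * C₁ * Real.exp (α * (b + 1)) / η))]
    have hlog : Real.sqrt (4 * C₁ * Real.exp (α * (b + 1)) / η) ≤ Real.log ((z : ℝ) - 1) := by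
      rw [Real.le_log_iff_exp_le hz1pos]; exact hge
    have hsq : 4 * C₁ * Real.exp (α * (b + 1)) / η ≤ Real.log ((z : ℝ) - 1) ^ 2 := by
      have h0 : 0 ≤ Real.sqrt (4 * C₁ * Real.exp (α * (b + 1)) / η) := Real.sqrt_nonneg _
      calc 4 * C₁ * Real.exp (α * (b + 1)) / η
          = Real.sqrt (4 * C₁ * Real.exp (α * (b + 1)) / η) ^ 2 := (Real.sq_sqrt (by positivity)).symm
        _ ≤ Real.log ((z : ℝ) - 1) ^ 2 := pow_le_pow_left₀ h0 hlog 2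
    have hl2 : 0 < Real.log ((z : ℝ) - 1) ^ 2 := by positivity
    calc 4 * C₁ / Real.log ((z : ℝ) - 1) ^ 2 * (Ztop : ℝ) ^ θ
        ≤ 4 * C₁ / Real.log ((z : ℝ) - 1) ^ 2 * Real.exp (α * (b + 1)) :=
          mul_le_mul_of_nonneg_left hZθ (by positivity)
      _ = (4 * C₁ * Real.exp (α * (b + 1))) / Real.log ((z : ℝ) - 1) ^ 2 := by ring
      _ ≤ η := by
          rw [div_le_iff₀ hl2]
          rw [div_le_iff₀ hη0] at hsq
          linarith only [hsq]
  -- (VI) `Sb ≤ I + t'`, `t' = (3 Mf + 1) η ≤ t`, hence `Sb^k/k! ≤ I^k/k! + ε₁`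
  set Sb : ℝ := ∑ p ∈ P, (#((range p).filter fun s : ℕ => p ∣ s ^ 3 + 2) : ℝ) * (p : ℝ) ^ (θ - 1)
    with hSbdef
  have hSb0 : 0 ≤ Sb := sum_nonneg fun p _ => by positivity
  have hSble : Sb ≤ I + (3 * Mf + 1) * η := by
    rw [hSb_eq]
    linarith only [hSb, hint, herr]
  have ht' : (3 * Mf + 1) * η ≤ t := by
    have h1 := hηt1
    rw [le_div_iff₀ (by positivity)] at h1
    calc (3 * Mf + 1) * η ≤ η * (4 * (Mf + 1)) := by nlinarith only [hMf0, hη0.le]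
      _ ≤ t := h1
  have hSbk : Sb ^ k / k.factorial ≤ I ^ k / k.factorial + ε / (4 * E) := by
    have h1 : Sb ^ k / k.factorial ≤ (I + (3 * Mf + 1) * η) ^ k / k.factorial :=
      div_le_div_of_nonneg_right (pow_le_pow_left₀ hSb0 hSble k) (by positivity)
    exact h1.trans (hcont _ (by positivity) ht')
  -- (VII) `Dm^{-θ} ≤ E (1 + η)`
  have hDmθ : Dm ^ (-θ) ≤ E * (1 + η) := by
    have hlogDm : Real.log Dm = ((e : ℝ)⁻¹) *
        (((h - k : ℕ) : ℝ) * (Real.log 3 + L) - (Real.log 10 + 3 * L)) := by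
      rw [hDm, Real.log_rpow hbase, Real.log_div (by positivity) (by positivity), Real.log_pow,
        Real.log_mul (by norm_num) (by positivity), Real.log_pow]
      push_cast
      rw [Real.log_mul (by norm_num) hX0.ne', hL]
    rw [Real.rpow_neg hDm0.le, ← Real.exp_log (Real.rpow_pos_of_pos hDm0 θ), Real.log_rpow hDm0,
      ← Real.exp_neg, hlogDm, hE]
    -- exponent comparison: `-(θ · logDm) ≤ -α σ + α log 10 / L`
    have hexp_le : -(θ * ((e : ℝ)⁻¹ * (((h - k : ℕ) : ℝ) * (Real.log 3 + L) - (Real.log 10 + 3 * L)))) ≤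
        -α * σ + α * Real.log 10 / L := by
      rw [hhkr, hθ, hσ, ← her']
      have hl3 : 0 ≤ Real.log 3 := Real.log_nonneg (by norm_num)
      have hl10 : 0 ≤ Real.log 10 := Real.log_nonneg (by norm_num)
      have hhk0 : 0 ≤ (h : ℝ) - k := by rw [← hhkr]; exact Nat.cast_nonneg _
      -- clear denominators `L > 0`, `e > 0`
      rw [show -(α / L * ((e : ℝ)⁻¹ * (((h : ℝ) - k) * (Real.log 3 + L) - (Real.log 10 + 3 * L)))) =
          (-(α * (((h : ℝ) - k) * (Real.log 3 + L) - (Real.log 10 + 3 * L)))) / (L * e) by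
            field_simp,
        show -α * (((h : ℝ) - k - 3) / (e : ℝ)) + α * Real.log 10 / L =
          (-α * ((h : ℝ) - k - 3) * L + α * Real.log 10 * e) / (L * e) by field_simp,
        div_le_div_iff_of_pos_right (by positivity)]
      have h1 : 0 ≤ α * ((h : ℝ) - k) * Real.log 3 := by positivity
      have h2 : α * Real.log 10 ≤ α * Real.log 10 * e :=
        le_mul_of_one_le_right (by positivity) (by exact_mod_cast he1)
      linarith only [h1, h2]
    have hτ' : α * Real.log 10 / L ≤ τ := by
      rw [div_le_iff₀ hL0]
      have := hLτ; rw [div_le_iff₀ hτ] at this; linarith only [this]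
    have hτ0 : 0 ≤ α * Real.log 10 / L := by
      have : 0 ≤ Real.log 10 := Real.log_nonneg (by norm_num)
      positivity
    calc Real.exp (-(θ * ((e : ℝ)⁻¹ * (((h - k : ℕ) : ℝ) * (Real.log 3 + L) - (Real.log 10 + 3 * L)))))
        ≤ Real.exp (-α * σ + α * Real.log 10 / L) := Real.exp_le_exp.2 hexp_le
      _ = Real.exp (-α * σ) * Real.exp (α * Real.log 10 / L) := Real.exp_add _ _
      _ ≤ Real.exp (-α * σ) * (1 + η) :=
          mul_le_mul_of_nonneg_left (hexpτ _ hτ0 hτ') (Real.exp_pos _).le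
  -- (VIII) `(3X)^θ ≤ e^{2α}` and the `2/z`-term `≤ η/3`
  have h3Xθ : ((3 * X : ℕ) : ℝ) ^ θ ≤ Real.exp (2 * α) := by
    rw [Real.rpow_def_of_pos hX3]
    refine Real.exp_le_exp.2 ?_
    have hlog3X : Real.log ((3 * X : ℕ) : ℝ) = Real.log 3 + L := by
      push_cast; rw [Real.log_mul (by norm_num) hX0.ne', hL]
    rw [hlog3X, hθ]
    rw [show (Real.log 3 + L) * (α / L) = α * ((Real.log 3 + L) / L) by field_simp]
    have : (Real.log 3 + L) / L ≤ 2 := by rw [div_le_iff₀ hL0]; linarith only [hL3']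
    calc α * ((Real.log 3 + L) / L) ≤ α * 2 := mul_le_mul_of_nonneg_left this hα.le
      _ = 2 * α := by ring
  have hXδsq : (X : ℝ) ^ (δ / 2) * (X : ℝ) ^ (δ / 2) = (X : ℝ) ^ δ := by
    rw [← Real.rpow_add hX0]; ring_nf
  have hLle : L ≤ 2 / δ * (X : ℝ) ^ (δ / 2) := by
    have := Real.log_le_rpow_div hX0.le (by positivity : 0 < δ / 2)
    rw [hL]
    calc Real.log X ≤ (X : ℝ) ^ (δ / 2) / (δ / 2) := this
      _ = 2 / δ * (X : ℝ) ^ (δ / 2) := by field_simp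
  have hterm2 : Real.exp (2 * α) * (Wk * ((1 + Real.log ((3 * X : ℕ) : ℝ)) * (2 / z))) ≤ η / 3 := by
    have hlog3X : 1 + Real.log ((3 * X : ℕ) : ℝ) = 1 + Real.log 3 + L := by
      push_cast; rw [Real.log_mul (by norm_num) hX0.ne', hL]; ring
    rw [hlog3X]
    have hzX : (X : ℝ) ^ δ ≤ z := hzge
    have hXδ2pos : 0 < (X : ℝ) ^ (δ / 2) := by positivity
    have h1 : Wk' * (1 + Real.log 3) * (2 / z) ≤ η / 6 := by
      have := div_le_of_mul_div_le hη0 hzr0 (hT1.trans hzX)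
      calc Wk' * (1 + Real.log 3) * (2 / z) = 2 * Wk' * (1 + Real.log 3) / z := by ring
        _ ≤ η / 6 := this
    have h2 : Wk' * L * (2 / z) ≤ η / 6 := by
      calc Wk' * L * (2 / z) ≤ Wk' * (2 / δ * (X : ℝ) ^ (δ / 2)) * (2 / (X : ℝ) ^ δ) := by gcongr
        _ = (4 * Wk' / δ) / (X : ℝ) ^ (δ / 2) := by rw [← hXδsq]; field_simp; ring
        _ ≤ η / 6 := div_le_of_mul_div_le hη0 hXδ2pos hT2
    calc Real.exp (2 * α) * (Wk * ((1 + Real.log 3 + L) * (2 / z)))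
        = Wk' * (1 + Real.log 3) * (2 / z) + Wk' * L * (2 / z) := by rw [hWk']; ring
      _ ≤ η / 6 + η / 6 := add_le_add h1 h2
      _ = η / 3 := by ring
  -- (IX) the sieve term `≤ ε/12 · X`
  have hε4 : 0 < ε / 4 := by positivity
  have hterm3 : Wk * (Kr * ((3 * X : ℕ) / Real.log z + (z : ℝ) ^ (10 : ℕ))) ≤ ε / 12 * X := by
    have hlogz0 : 0 < Real.log z := lt_of_lt_of_le hδL hlogz
    have hWk0 : 0 ≤ Wk := by linarith only [hWk1]
    have h1 : Wk * Kr * ((3 * X : ℕ) / Real.log z) ≤ ε / 4 / 6 * X := by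
      push_cast
      calc Wk * Kr * (3 * (X : ℝ) / Real.log z) ≤ Wk * Kr * (3 * (X : ℝ) / (δ * L)) := by gcongr
        _ = (3 * Wk * Kr / δ) / L * X := by field_simp
        _ ≤ ε / 4 / 6 * X :=
            mul_le_mul_of_nonneg_right (div_le_of_mul_div_le hε4 hL0 hT3) hX0.le
    have h2 : Wk * Kr * (z : ℝ) ^ (10 : ℕ) ≤ ε / 4 / 6 * X := by
      have hz2X : (z : ℝ) ≤ 2 * (X : ℝ) ^ δ := by linarith only [hzle, hz4]
      have hpow : (z : ℝ) ^ (10 : ℕ) ≤ 1024 * (X : ℝ) ^ ((1 : ℝ) / 2) := by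
        calc (z : ℝ) ^ (10 : ℕ) ≤ (2 * (X : ℝ) ^ δ) ^ (10 : ℕ) := pow_le_pow_left₀ hzr0.le hz2X 10
          _ = 1024 * ((X : ℝ) ^ δ) ^ (10 : ℕ) := by ring
          _ = 1024 * (X : ℝ) ^ (10 * δ) := by
              rw [← Real.rpow_natCast, ← Real.rpow_mul hX0.le]; ring_nf
          _ ≤ 1024 * (X : ℝ) ^ ((1 : ℝ) / 2) := by
              gcongr
              · exact_mod_cast hX1
              · linarith only [hδ']
      have hXhalfpos : 0 < (X : ℝ) ^ ((1 : ℝ) / 2) := by positivity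
      have hXsq : (X : ℝ) ^ ((1 : ℝ) / 2) * (X : ℝ) ^ ((1 : ℝ) / 2) = X := by
        rw [← Real.rpow_add hX0]; norm_num
      have hq : 1024 * Wk * Kr ≤ ε / 4 / 6 * (X : ℝ) ^ ((1 : ℝ) / 2) := by
        have := div_le_of_mul_div_le hε4 hXhalfpos hT4
        rwa [div_le_iff₀ hXhalfpos] at this
      calc Wk * Kr * (z : ℝ) ^ (10 : ℕ) ≤ Wk * Kr * (1024 * (X : ℝ) ^ ((1 : ℝ) / 2)) := by gcongr
        _ = (1024 * Wk * Kr) * (X : ℝ) ^ ((1 : ℝ) / 2) := by ring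
        _ ≤ (ε / 4 / 6 * (X : ℝ) ^ ((1 : ℝ) / 2)) * (X : ℝ) ^ ((1 : ℝ) / 2) :=
            mul_le_mul_of_nonneg_right hq hXhalfpos.le
        _ = ε / 4 / 6 * X := by rw [mul_assoc, hXsq]
    calc Wk * (Kr * ((3 * X : ℕ) / Real.log z + (z : ℝ) ^ (10 : ℕ)))
        = Wk * Kr * ((3 * X : ℕ) / Real.log z) + Wk * Kr * (z : ℝ) ^ (10 : ℕ) := by ring
      _ ≤ ε / 4 / 6 * X + ε / 4 / 6 * X := add_le_add h1 h2
      _ = ε / 12 * X := by ring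
  -- (X) `#D` by the sieve
  have hcardD : (#D : ℝ) ≤ Kr * ((3 * X : ℕ) / Real.log z + (z : ℝ) ^ (10 : ℕ)) := hDcard X z h k hz2
  -- (XI) combine
  have hbracket : Sb ^ k / k.factorial +
      ((3 * X : ℕ) : ℝ) ^ θ * (Wk * ((1 + Real.log ((3 * X : ℕ) : ℝ)) * (2 / z))) ≤
      I ^ k / k.factorial + ε / (4 * E) + η / 3 := by
    have h2 : ((3 * X : ℕ) : ℝ) ^ θ * (Wk * ((1 + Real.log ((3 * X : ℕ) : ℝ)) * (2 / z))) ≤ η / 3 := by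
      refine le_trans (mul_le_mul_of_nonneg_right h3Xθ ?_) hterm2
      have h13 : (1 : ℝ) ≤ ((3 * X : ℕ) : ℝ) := by exact_mod_cast (show 1 ≤ 3 * X by omega)
      have hlog : 0 ≤ 1 + Real.log ((3 * X : ℕ) : ℝ) := by
        have := Real.log_nonneg h13; linarith only [this]
      exact mul_nonneg (by linarith only [hWk1]) (mul_nonneg hlog (div_nonneg (by norm_num) hzr0.le))
    linarith only [hSbk, h2]
  have hνsum : ∑ d ∈ De, a d ≤
      E * (1 + η) * (I ^ k / k.factorial + ε / (4 * E) + η / 3) := by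
    refine htilt.trans ?_
    have hbr0 : 0 ≤ Sb ^ k / k.factorial +
        ((3 * X : ℕ) : ℝ) ^ θ * (Wk * ((1 + Real.log ((3 * X : ℕ) : ℝ)) * (2 / z))) := by
      have h13 : (1 : ℝ) ≤ ((3 * X : ℕ) : ℝ) := by exact_mod_cast (show 1 ≤ 3 * X by omega)
      have hlog : 0 ≤ 1 + Real.log ((3 * X : ℕ) : ℝ) := by
        have := Real.log_nonneg h13; linarith only [this]
      refine add_nonneg (div_nonneg (pow_nonneg hSb0 k) (Nat.cast_nonneg _)) ?_
      refine mul_nonneg (Real.rpow_nonneg hX3.le _) (mul_nonneg (by linarith only [hWk1]) ?_)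
      exact mul_nonneg hlog (div_nonneg (by norm_num) hzr0.le)
    calc Dm ^ (-θ) * (Sb ^ k / k.factorial +
          ((3 * X : ℕ) : ℝ) ^ θ * ((W : ℝ) ^ k * ((1 + Real.log ((3 * X : ℕ) : ℝ)) * (2 / z))))
        ≤ (E * (1 + η)) * (Sb ^ k / k.factorial +
          ((3 * X : ℕ) : ℝ) ^ θ * (Wk * ((1 + Real.log ((3 * X : ℕ) : ℝ)) * (2 / z)))) := by
          rw [← hWk]; exact mul_le_mul_of_nonneg_right hDmθ hbr0
      _ ≤ (E * (1 + η)) * (I ^ k / k.factorial + ε / (4 * E) + η / 3) :=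
          mul_le_mul_of_nonneg_left hbracket (mul_nonneg hE0.le (by linarith only [hη0]))
  -- the `ε`-bookkeeping
  have hIk0 : 0 ≤ I ^ k / k.factorial := by positivity
  have hextra : E * (1 + η) * (I ^ k / k.factorial + ε / (4 * E) + η / 3) ≤
      E * (I ^ k / k.factorial) + 3 * ε / 4 := by
    have hε4E : 0 ≤ ε / (4 * E) := by positivity
    have hηE : E * η * (I ^ k / k.factorial + 1) ≤ ε / 4 := by
      have hden : 0 < 4 * (E + 1) * (I ^ k / k.factorial + ε / (4 * E) + 1) + 1 := by positivity
      have h1 := hηε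
      rw [le_div_iff₀ hden] at h1
      have h2 : E * η * (I ^ k / k.factorial + 1) ≤
          (E + 1) * η * (I ^ k / k.factorial + ε / (4 * E) + 1) := by
        have ha : E * η ≤ (E + 1) * η := by nlinarith only [hη0.le]
        have hb : I ^ k / k.factorial + 1 ≤ I ^ k / k.factorial + ε / (4 * E) + 1 := by
          linarith only [hε4E]
        exact mul_le_mul ha hb (by positivity) (by positivity)
      have h3 : (E + 1) * η * (I ^ k / k.factorial + ε / (4 * E) + 1) =
          η * (4 * (E + 1) * (I ^ k / k.factorial + ε / (4 * E) + 1) + 1) / 4 - η / 4 := by ring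
      linarith only [h1, h2, h3, hη0]
    have hEε : E * (1 + η) * (ε / (4 * E)) ≤ ε / 2 := by
      rw [show E * (1 + η) * (ε / (4 * E)) = (1 + η) * ε / 4 by field_simp]
      have : (1 + η) * ε ≤ 2 * ε := mul_le_mul_of_nonneg_right (by linarith only [hη1]) hε.le
      linarith only [this]
    have hEη : E * (1 + η) * (η / 3) ≤ E * η := by
      have h1 : (1 + η) / 3 ≤ 1 := by linarith only [hη1]
      calc E * (1 + η) * (η / 3) = E * η * ((1 + η) / 3) := by ring
        _ ≤ E * η * 1 := mul_le_mul_of_nonneg_left h1 (by positivity)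
        _ = E * η := by ring
    have hexp : E * (1 + η) * (I ^ k / k.factorial + ε / (4 * E) + η / 3) =
        E * (I ^ k / k.factorial) + (E * η * (I ^ k / k.factorial + 1) - E * η) +
          E * (1 + η) * (ε / (4 * E)) + E * (1 + η) * (η / 3) := by ring
    linarith only [hexp, hηE, hEε, hEη]
  rw [← hI]
  have hXε := mul_pos hX0 hε
  calc (∑ d ∈ De, (#((Ioc X (2 * X)).filter fun n : ℕ => d ∣ n ^ 3 + 2) : ℝ))
      ≤ X * ∑ d ∈ De, a d + Wk * #D := hsumA
    _ ≤ X * (E * (I ^ k / k.factorial) + 3 * ε / 4) + ε / 12 * X := by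
        refine add_le_add ?_ ?_
        · exact mul_le_mul_of_nonneg_left (hνsum.trans hextra) hX0.le
        · refine le_trans (mul_le_mul_of_nonneg_left hcardD (by linarith only [hWk1])) hterm3
    _ ≤ (E * I ^ k / k.factorial + ε) * X := by
        have e1 : X * (E * (I ^ k / k.factorial) + 3 * ε / 4) + ε / 12 * X =
            (E * I ^ k / k.factorial + ε) * X - (ε / 6) * X := by ring
        rw [e1]
        linarith only [hXε]

end TermK

/-! ## Irving's Lemma 4.2 -/

section Lemma42

open MeasureTheory intervalIntegral Filter Topology

/-- The term `k = K` of Lemma 4.2 (no maximality constraint): the vacuous conjunct is dropped and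
`sum_card_dvd_divisorSet_le_eventually` applies. [cite: Irving2014LargestPrimeFactorCubic, Lemma 4.2] -/
theorem sum_card_dvd_divisorSetK_top_le_eventually {δ : ℝ} (hδ : 0 < δ) (hδ' : δ ≤ 1 / 20)
    {h K : ℕ} (hρ : ((h - K + 1 : ℕ) : ℝ) * δ ≤ 3 - ((K - 1 : ℕ) : ℝ) * δ) {ε : ℝ} (hε : 0 < ε) :
    ∀ᶠ X : ℕ in atTop,
      (∑ d ∈ (Icc 1 (3 * X)).filter (fun d : ℕ => ArithmeticFunction.cardFactors d = K ∧
          (∀ p ∈ d.primeFactors, ⌈(X : ℝ) ^ δ⌉₊ ≤ p ∧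
            ⌈(X : ℝ) ^ δ⌉₊ ^ (K - 1) * p ^ (h - K + 1) ≤ 10 * X ^ 3) ∧
          (K < K → (3 * X) ^ (h - K) < 10 * X ^ 3 * d ^ (h - K - 1))),
        (#((Ioc X (2 * X)).filter fun n : ℕ => d ∣ n ^ 3 + 2) : ℝ)) ≤
        ((Real.log ((3 - ((K - 1 : ℕ) : ℝ) * δ) / (((h - K + 1 : ℕ) : ℝ) * δ))) ^ K /
            K.factorial + ε) * X := by
  filter_upwards [sum_card_dvd_divisorSet_le_eventually hδ hδ' (h := h) (k := K) hρ hε] with X hX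
  refine le_trans ?_ hX
  refine sum_le_sum_of_subset_of_nonneg (fun d hd => ?_) (fun d _ _ => by positivity)
  rw [mem_filter] at hd ⊢
  exact ⟨hd.1, hd.2.1, hd.2.2.1⟩

/-- **Irving 2015, Lemma 4.2** (second estimate for `T(h,δ)`), rational form with an explicit
`ε`: let `0 < δ ≤ 1/20`, `h ≥ 3`, `[h/3] ≤ K ≤ h − 1`, positive reals `α_k`, and assume
`(h−k+1)δ ≤ 3 − (k−1)δ` for `[h/3] ≤ k ≤ K`.  Then for every `ε > 0`, for all large `X`,
`T(h,δ) ≤ X·(∑_{k=[h/3]}^{K-1} e^{-α_k(h-k-3)/(h-k-1)}/k!·(∫_δ^{b_k} e^{α_k s} ds/s)^k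
+ (1/K!)(log(b_K/δ))^K + ε)`, `b_k = (3−(k−1)δ)/(h−k+1)`
(Irving's display, with `∫_δ^{(3-(k-1)δ)/(h-k+1)} exp(α_k s) ds/s`).  Proof: the covering
`card_largeOmega_le_sum_sum_divisorSet` and, term by term, `sum_card_dvd_divisorSetK_le_eventually`
(`k < K`) and `sum_card_dvd_divisorSetK_top_le_eventually` (`k = K`), each with `ε/(K+1)`.
[cite: Irving2014LargestPrimeFactorCubic, Lemma 4.2] -/
theorem irving_lemma_4_2 {δ : ℝ} (hδ : 0 < δ) (hδ' : δ ≤ 1 / 20) {h K : ℕ} (hh : 3 ≤ h)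
    (hK : h / 3 ≤ K) (hKh : K + 1 ≤ h)
    (hρ : ∀ k ∈ Icc (h / 3) K, ((h - k + 1 : ℕ) : ℝ) * δ ≤ 3 - ((k - 1 : ℕ) : ℝ) * δ)
    (α : ℕ → ℝ) (hα : ∀ k, 0 < α k) {ε : ℝ} (hε : 0 < ε) :
    ∀ᶠ X : ℕ in atTop,
      (#((Ioc X (2 * X)).filter fun n : ℕ =>
          h ≤ ((Nat.primeFactorsList (n ^ 3 + 2)).filter
            (fun p => ⌈(X : ℝ) ^ δ⌉₊ ≤ p)).length) : ℝ) ≤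
        (∑ k ∈ Ico (h / 3) K, Real.exp (-α k * (((h : ℝ) - k - 3) / ((h : ℝ) - k - 1))) *
              (∫ s in δ..(3 - ((k - 1 : ℕ) : ℝ) * δ) / ((h - k + 1 : ℕ) : ℝ),
                Real.exp (α k * s) / s) ^ k / k.factorial +
            (Real.log ((3 - ((K - 1 : ℕ) : ℝ) * δ) / (((h - K + 1 : ℕ) : ℝ) * δ))) ^ K /
              K.factorial + ε) * X := by
  set k₀ := h / 3 with hk₀
  have hε' : 0 < ε / (K + 1) := by positivity
  -- term by term
  have hev : ∀ k ∈ Ico k₀ K, ∀ᶠ X : ℕ in atTop,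
      (∑ d ∈ (Icc 1 (3 * X)).filter (fun d : ℕ => ArithmeticFunction.cardFactors d = k ∧
          (∀ p ∈ d.primeFactors, ⌈(X : ℝ) ^ δ⌉₊ ≤ p ∧
            ⌈(X : ℝ) ^ δ⌉₊ ^ (k - 1) * p ^ (h - k + 1) ≤ 10 * X ^ 3) ∧
          (k < K → (3 * X) ^ (h - k) < 10 * X ^ 3 * d ^ (h - k - 1))),
        (#((Ioc X (2 * X)).filter fun n : ℕ => d ∣ n ^ 3 + 2) : ℝ)) ≤
        (Real.exp (-α k * (((h : ℝ) - k - 3) / ((h : ℝ) - k - 1))) *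
            (∫ s in δ..(3 - ((k - 1 : ℕ) : ℝ) * δ) / ((h - k + 1 : ℕ) : ℝ),
              Real.exp (α k * s) / s) ^ k / k.factorial + ε / (K + 1)) * X := by
    intro k hk
    rw [mem_Ico] at hk
    exact sum_card_dvd_divisorSetK_le_eventually hδ hδ' hk.2 hKh
      (hρ k (mem_Icc.2 ⟨hk.1, hk.2.le⟩)) (hα k) hε'
  have hevK := sum_card_dvd_divisorSetK_top_le_eventually hδ hδ' (h := h) (K := K)
    (hρ K (mem_Icc.2 ⟨hK, le_rfl⟩)) hε'
  rw [← Filter.eventually_all_finset] at hev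
  filter_upwards [hev, hevK, eventually_ge_atTop 1] with X hlt htop hX1
  have hX0 : (0 : ℝ) ≤ X := Nat.cast_nonneg X
  -- the covering
  have hz1 : 1 ≤ ⌈(X : ℝ) ^ δ⌉₊ :=
    Nat.ceil_pos.2 (Real.rpow_pos_of_pos (by exact_mod_cast hX1) δ)
  have hcov := card_largeOmega_le_sum_sum_divisorSet X ⌈(X : ℝ) ^ δ⌉₊ h K hz1 hh hK hKh
  have hcovr : (#((Ioc X (2 * X)).filter fun n : ℕ =>
      h ≤ ((Nat.primeFactorsList (n ^ 3 + 2)).filter (fun p => ⌈(X : ℝ) ^ δ⌉₊ ≤ p)).length) : ℝ) ≤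
      ∑ k ∈ Icc k₀ K, (∑ d ∈ (Icc 1 (3 * X)).filter (fun d : ℕ =>
          ArithmeticFunction.cardFactors d = k ∧
          (∀ p ∈ d.primeFactors, ⌈(X : ℝ) ^ δ⌉₊ ≤ p ∧
            ⌈(X : ℝ) ^ δ⌉₊ ^ (k - 1) * p ^ (h - k + 1) ≤ 10 * X ^ 3) ∧
          (k < K → (3 * X) ^ (h - k) < 10 * X ^ 3 * d ^ (h - k - 1))),
        (#((Ioc X (2 * X)).filter fun n : ℕ => d ∣ n ^ 3 + 2) : ℝ)) := by
    exact_mod_cast hcov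
  refine hcovr.trans ?_
  -- split off `k = K`
  rw [← Finset.Ico_add_one_right_eq_Icc, sum_Ico_succ_top hK]
  -- bound each part
  have h1 : ∑ k ∈ Ico k₀ K, (∑ d ∈ (Icc 1 (3 * X)).filter (fun d : ℕ =>
          ArithmeticFunction.cardFactors d = k ∧
          (∀ p ∈ d.primeFactors, ⌈(X : ℝ) ^ δ⌉₊ ≤ p ∧
            ⌈(X : ℝ) ^ δ⌉₊ ^ (k - 1) * p ^ (h - k + 1) ≤ 10 * X ^ 3) ∧
          (k < K → (3 * X) ^ (h - k) < 10 * X ^ 3 * d ^ (h - k - 1))),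
        (#((Ioc X (2 * X)).filter fun n : ℕ => d ∣ n ^ 3 + 2) : ℝ)) ≤
      ∑ k ∈ Ico k₀ K, (Real.exp (-α k * (((h : ℝ) - k - 3) / ((h : ℝ) - k - 1))) *
            (∫ s in δ..(3 - ((k - 1 : ℕ) : ℝ) * δ) / ((h - k + 1 : ℕ) : ℝ),
              Real.exp (α k * s) / s) ^ k / k.factorial + ε / (K + 1)) * X :=
    sum_le_sum (fun k hk => hlt k hk)
  refine (add_le_add h1 htop).trans ?_
  -- the `ε`-count: `(#Ico + 1) ε/(K+1) ≤ ε`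
  have hcard : ((Ico k₀ K).card : ℝ) + 1 ≤ K + 1 := by
    have : (Ico k₀ K).card ≤ K := by rw [Nat.card_Ico]; omega
    exact_mod_cast Nat.add_le_add_right this 1
  have hεsum : (((Ico k₀ K).card : ℝ) + 1) * (ε / (K + 1)) ≤ ε := by
    rw [← mul_div_assoc, div_le_iff₀ (by positivity)]
    calc (((Ico k₀ K).card : ℝ) + 1) * ε = ε * (((Ico k₀ K).card : ℝ) + 1) := by ring
      _ ≤ ε * (K + 1) := mul_le_mul_of_nonneg_left hcard hε.le
  have e1 : ∑ k ∈ Ico k₀ K, (Real.exp (-α k * (((h : ℝ) - k - 3) / ((h : ℝ) - k - 1))) *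
        (∫ s in δ..(3 - ((k - 1 : ℕ) : ℝ) * δ) / ((h - k + 1 : ℕ) : ℝ),
          Real.exp (α k * s) / s) ^ k / k.factorial + ε / (K + 1)) * X =
      (∑ k ∈ Ico k₀ K, Real.exp (-α k * (((h : ℝ) - k - 3) / ((h : ℝ) - k - 1))) *
        (∫ s in δ..(3 - ((k - 1 : ℕ) : ℝ) * δ) / ((h - k + 1 : ℕ) : ℝ),
          Real.exp (α k * s) / s) ^ k / k.factorial) * X +
        ((Ico k₀ K).card : ℝ) * (ε / (K + 1) * X) := by
    rw [sum_mul, sum_congr rfl (fun k _ => add_mul _ _ (X : ℝ)), sum_add_distrib, sum_const,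
      nsmul_eq_mul]
  rw [e1]
  have key := mul_le_mul_of_nonneg_right hεsum hX0
  linarith only [key]

end Lemma42

end Irving2015

end Literature.NumberTheory.Sieve
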